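import Summits.NavierStokesRegularity.NavierStokesRegularity.Theses.StretchingWellBinding
import Summits.NavierStokesRegularity.NavierStokesRegularity.Theses.TypeILiouville
import Summits.NavierStokesRegularity.NavierStokesRegularity.Theses.HalfHolderEnergy
import Summits.NavierStokesRegularity.NavierStokesRegularity.Theorems.StretchingWellBindingEnstrophyQuarterLawWindowToSlice
import HarnessLib.Audit

/-!
# Line `window-average` on the crux `EnstrophyQuarterLaw` (stmt-NavierStokesRegularity-1574)

Crux Q (FIXED, by name `Theses.StretchingWellBinding.EnstrophyQuarterLaw`): a maximal classical Leray–Hopf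
solution from a rapidly decaying datum on `[0,T)` has the SLICE quarter law `Ω(t) = ∫|curl u(t)|² ≤ K/√(T−t)`.

Idea (`Cruxes/EnstrophyQuarterLaw/Ideas/window-average.md`): Q is EXACTLY "WINDOW quarter law ∧ sup-norm Type I":
* `stub_energyHalfHolder` — the window law `∫_a^b Ω ≤ K √(b−a)` (kinetic energy uniformly ½-Hölder on `[0,T]`),
  item stmt-NavierStokesRegularity-25161 of route `HalfHolderEnergy`, BY NAME. It is implied by Q (integrate) and
  does not imply Q (thin Riccati spikes of height `H`, width `ν³/H²`, mass `ν³/H` respect every window bound), so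
  it is the budget/modulus half of Q with the rate content removed.
* `stub_noTypeII` — sup-norm Type I, the sibling crux `Theses.TypeILiouville.TypeIliouvilleNoTypeII`
  (stmt-NavierStokesRegularity-0056, shared), BY NAME — the rate half (Q ⇒ it by the H¹ local theory a fixed
  fraction of the lifespan later; recorded in `Lines/birth.md`).
* `stub_windowToSlice` — the CONVERTER (provable now, M–L): under `‖u(s)‖_∞ ≤ M/√(T−s)` the enstrophy balance
  `Ω' ≤ ‖u‖²_∞ Ω/ν` (absorb the stretching term `|∫ω·∇u·ω| ≤ ‖u‖_∞‖ω‖‖∇ω‖` into the dissipation) integrates over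
  the window `[t−(T−t), t]` to `Ω(t) ≤ 2^{M²/ν} Ω(s)`; averaging in `s` and the window law give
  `Ω(t) ≤ 2^{M²/ν} K √(T−t)/(T−t) = K'/√(T−t)` for `t ≥ T/2` (and for `t` before the Type-I onset / `T/2` the
  classical solution has bounded enstrophy: Grönwall from `Ω(0) < ∞`).
The composition `EnstrophyQuarterLaw_of` is modus ponens; all difficulty sits in the two named items, none hidden.

Delta w.r.t. `Lines/birth.lean` (stubs `stub_noTypeII`, `stub_typeICells`, `stub_cellIntegral`): birth's heart is a
POINTWISE self-similar envelope on FINITELY MANY cells (needs finiteness of the singular set and `|y|⁻²` tails, its own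
why-might-fail (a)(b)); this line's heart is a GLOBAL INTEGRAL statement (the window law) that needs neither — every
cell, however many, pays into the same Leray budget — and the converter is one Grönwall average, no geometry.
-/

namespace Summit.NavierStokesRegularity.NavierStokesRegularity.Cruxes.EnstrophyQuarterLaw.WindowAverage

set_option linter.unusedVariables false
set_option linter.dupNamespace false

open Literature.Analysis.FluidPDE

/-- The converter statement: sup-norm Type I + the window law ⇒ the slice law, for one solution. -/
def WindowToSlice : Prop :=
  ∀ (ν T : ℝ), 0 < ν → 0 < T → ∀ (u : ℝ → EuclideanSpace ℝ (Fin 3) → EuclideanSpace ℝ (Fin 3))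
    (p : ℝ → EuclideanSpace ℝ (Fin 3) → ℝ), IsMaximalSmoothSolution ν 0 u p T → IsLerayHopfOn T ν 0 (u 0) u →
    HasRapidSpatialDecay (u 0) → IsTypeIBlowup u T →
    (∃ K : ℝ, ∀ a b : ℝ, 0 ≤ a → a ≤ b → b ≤ T →
      ∫⁻ t in Set.Ioo a b, ∫⁻ x, ‖curl (u t) x‖ₑ ^ 2 ≤ ENNReal.ofReal (K * Real.sqrt (b - a))) →
    ∃ K' : ℝ, ∀ t ∈ Set.Ico 0 T, ∫⁻ x, ‖curl (u t) x‖ₑ ^ 2 ≤ ENNReal.ofReal (K' / Real.sqrt (T - t))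

/-- **stub 1 — `stub_energyHalfHolder` (XL, OPEN; item stmt-NavierStokesRegularity-25161 BY NAME; the heart).**
The window quarter law / energy ½-Hölder at a first blow-up. Sources: Leray 1934 (budget + lower rate), RRS2016
Lemma 6.11 / Thm 8.13, Seregin 2007 (one scaled quantity), AlbrittonBarker2019 arXiv:1811.00502 L2.6; why it might
fail: the averaged cascade (Tao 2016) violates it (`e_k/√τ_k → ∞`), so only genuine-NS structure can prove it. -/
theorem stub_energyHalfHolder :
    Summit.NavierStokesRegularity.NavierStokesRegularity.Theses.HalfHolderEnergy.EnergyHalfHolder := by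
  sorry

/-- **stub 2 — `stub_noTypeII` (XL, OPEN; the sibling crux stmt-NavierStokesRegularity-0056 BY NAME; shared with
`Lines/birth.lean`).** Sup-norm Type I at a finite classical lifespan. -/
theorem stub_noTypeII :
    Summit.NavierStokesRegularity.NavierStokesRegularity.Theses.TypeILiouville.TypeIliouvilleNoTypeII := by
  sorry

/-- **stub 3 — `stub_windowToSlice` (M–L, provable now: enstrophy balance + Grönwall over one window + average).** -/
-- CLOSED 2026-08-28 (p608800, ns-hhe-c1 g0): the converter is the landed theorem
-- `Theorems.EnstrophyQuarterLaw.stub_windowToSlice` (type = the body of `WindowToSlice`, defeq).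
theorem stub_windowToSlice : WindowToSlice :=
  Summit.NavierStokesRegularity.NavierStokesRegularity.Theorems.EnstrophyQuarterLaw.stub_windowToSlice

/-- **The skeleton theorem** — concludes the crux `Theses.StretchingWellBinding.EnstrophyQuarterLaw` BY NAME, no
hypotheses; placeholders only inside the three declared stubs, all three used by name (pure logic). -/
theorem EnstrophyQuarterLaw_of : Theses.StretchingWellBinding.EnstrophyQuarterLaw := by
  intro ν T hν hT u p hmax hLH hdec
  exact stub_windowToSlice ν T hν hT u p hmax hLH hdec (stub_noTypeII ν T hν hT u p hmax hLH hdec)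
    (stub_energyHalfHolder ν T hν hT u p hmax hLH hdec)

end Summit.NavierStokesRegularity.NavierStokesRegularity.Cruxes.EnstrophyQuarterLaw.WindowAverage
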